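import Summits.QuantumFields.YangMills.Theorems.ComplexCouplingChannelHarmonicMeasureEngineDiscChain

/-!
# Two-constants estimate along disc chains, uniformly on compact sets

Stub `stub_chainOnCompacts` of line `Sketch` for the crux `FreeEnergyWindowChannel`
(`stmt-QuantumFields-18842`, route `ComplexCouplingChannel` of `QuantumFields/YangMills`).

The tree theorem `exists_exponent_norm_le_rpow_mul_rpow`
(`ComplexCouplingChannelHarmonicMeasureEngineDiscChain`) transports the smallness of a bounded holomorphic
function from the disc `D ∩ ball x r₀` to ONE point `β` of an open preconnected `D ⊆ ℂ`, with an exponent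
`θ = 2^{-N}` independent of the function.  Its proof actually bounds the function on the whole last disc
`closedBall β ρ` of the chain, with a radius `ρ = ρ(D, x, r₀, β) > 0` that does not depend on the function
either.  Here we record that local version (`exists_exponent_norm_le_on_ball`), the antitonicity of the
two-constants interpolant `ε ^ θ * B ^ (1 - θ)` in `θ` for `0 < ε ≤ B` (`rpow_interp_antitone`), and deduce,
by a finite subcover, the estimate with ONE exponent valid on a whole compact `K ⊆ D`
(`stub_chainOnCompacts`).

References: R. Nevanlinna, *Eindeutige analytische Funktionen* (1936), §III.2 (two-constants theorem);
T. Ransford, *Potential theory in the complex plane* (1995), §4.3; Mathlib `Complex.HadamardThreeLines`.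
-/

open Complex Metric Set Filter Topology

namespace Summit.QuantumFields.YangMills.Theorems.FreeEnergyWindowChannel

open Summit.QuantumFields.YangMills.Theorems.ComplexCouplingChannel

/-- Antitonicity of the two-constants interpolant in the exponent: for `0 < ε ≤ B` and `θ ≤ θ'`,
`ε ^ θ' * B ^ (1 - θ') ≤ ε ^ θ * B ^ (1 - θ)`. [folklore] -/
theorem rpow_interp_antitone {ε B θ θ' : ℝ} (hε : 0 < ε) (hεB : ε ≤ B) (hθθ' : θ ≤ θ') :
    ε ^ θ' * B ^ (1 - θ') ≤ ε ^ θ * B ^ (1 - θ) := by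
  have hB : 0 < B := lt_of_lt_of_le hε hεB
  have h1 : ε ^ θ' = ε ^ θ * ε ^ (θ' - θ) := by
    rw [← Real.rpow_add hε]; congr 1; ring
  have h2 : B ^ (1 - θ) = B ^ (θ' - θ) * B ^ (1 - θ') := by
    rw [← Real.rpow_add hB]; congr 1; ring
  rw [h1, h2, mul_assoc]
  refine mul_le_mul_of_nonneg_left ?_ (Real.rpow_nonneg hε.le _)
  exact mul_le_mul_of_nonneg_right
    (Real.rpow_le_rpow hε.le hεB (by linarith)) (Real.rpow_nonneg hB.le _)

/-- **Two-constants estimate along a chain of discs, local form.**  Let `D ⊆ ℂ` be open and preconnected,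
`x, β ∈ D`, `r₀ > 0`.  There are an exponent `θ ∈ (0, 1]` and a radius `s > 0` — both depending only on
`(D, x, r₀, β)`, not on the function — such that for every `h` complex differentiable on `D` with `‖h‖ ≤ K`
on `D` and `‖h‖ ≤ ε` on `D ∩ ball x r₀`, where `0 < ε ≤ K`, one has `‖h z‖ ≤ ε ^ θ * K ^ (1 - θ)` for all
`z ∈ ball β s`.  Proof: verbatim the chain of Hadamard three-circles discs of
`exists_exponent_norm_le_rpow_mul_rpow` (join `x` to `β` by a path in `D`, thicken its compact range inside
`D`, cover it by `N` discs of radius `ρ` with consecutive centres closer than `ρ`, iterate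
`norm_le_sqrt_of_three_circles`); the induction bounds `h` on the whole last disc `closedBall β ρ`, so
`s = ρ`, `θ = 2^{-N}`. [folklore] -/
theorem exists_exponent_norm_le_on_ball {D : Set ℂ} (hD : IsOpen D) (hDc : IsPreconnected D)
    {x β : ℂ} (hx : x ∈ D) (hβ : β ∈ D) {r₀ : ℝ} (hr₀ : 0 < r₀) :
    ∃ θ : ℝ, 0 < θ ∧ θ ≤ 1 ∧ ∃ s : ℝ, 0 < s ∧ ∀ (h : ℂ → ℂ) (K ε : ℝ), DifferentiableOn ℂ h D →
      0 < ε → ε ≤ K → (∀ z ∈ D, ‖h z‖ ≤ K) → (∀ z ∈ D, dist z x < r₀ → ‖h z‖ ≤ ε) →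
        ∀ z ∈ ball β s, ‖h z‖ ≤ ε ^ θ * K ^ (1 - θ) := by
  -- adapted from `exists_exponent_norm_le_rpow_mul_rpow` (tree, DiscChain file)
  -- a path from `x` to `β` inside `D`
  have hpath : IsPathConnected D := hD.isConnected_iff_isPathConnected.1 ⟨⟨x, hx⟩, hDc⟩
  have hJ : JoinedIn D x β := hpath.joinedIn x hx β hβ
  set γ : Path x β := hJ.somePath with hγ
  have hγD : ∀ t, γ t ∈ D := hJ.somePath_mem
  -- a closed thickening of its compact range inside `D`
  obtain ⟨δ, hδ0, hδD⟩ := (isCompact_range γ.continuous).exists_cthickening_subset_open hD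
    (range_subset_iff.2 hγD)
  -- the disc radius
  set ρ : ℝ := min δ r₀ / 4 with hρ
  have hmin : 0 < min δ r₀ := lt_min hδ0 hr₀
  have hρ0 : 0 < ρ := by rw [hρ]; positivity
  have hρδ : 4 * ρ ≤ δ := by rw [hρ]; linarith [min_le_left δ r₀]
  have hρr : ρ < r₀ := by rw [hρ]; linarith [min_le_right δ r₀]
  -- the spacing of the chain, from uniform continuity of the extended path
  obtain ⟨η, hη0, hη⟩ := Metric.uniformContinuous_iff.1 γ.uniformContinuous_extend ρ hρ0
  obtain ⟨k, hk⟩ := exists_nat_one_div_lt hη0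
  set N : ℕ := k + 1 with hN
  have hN0 : (0 : ℝ) < N := by rw [hN]; positivity
  have hNinv : 1 / (N : ℝ) < η := by rw [hN]; push_cast; exact hk
  -- the centres
  set c : ℕ → ℂ := fun j => γ.extend ((j : ℝ) / N) with hc
  have hcmem : ∀ j, c j ∈ range γ := fun j => by
    rw [← γ.extend_range]; exact mem_range_self _
  have hc0 : c 0 = x := by simp [hc]
  have hcN : c N = β := by
    simp only [hc]
    rw [div_self hN0.ne', Path.extend_one]
  have hstep : ∀ j : ℕ, dist (c (j + 1)) (c j) < ρ := by
    intro j
    refine hη ?_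
    rw [Real.dist_eq, Nat.cast_succ, show ((j : ℝ) + 1) / N - j / N = 1 / N from by ring,
      abs_of_pos (by positivity)]
    exact hNinv
  have hball : ∀ j, closedBall (c j) (4 * ρ) ⊆ D := fun j =>
    (closedBall_subset_closedBall hρδ).trans ((closedBall_subset_cthickening (hcmem j) δ).trans hδD)
  -- the exponent `2^{-N}` and the radius `ρ`
  refine ⟨(1 / 2 : ℝ) ^ N, by positivity, pow_le_one₀ (by norm_num) (by norm_num), ρ, hρ0, ?_⟩
  intro h K ε hh hε hεK hK hsmall
  have hK0 : 0 < K := lt_of_lt_of_le hε hεK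
  -- propagation along the chain
  have hind : ∀ j : ℕ, ∀ z ∈ closedBall (c j) ρ,
      ‖h z‖ ≤ ε ^ ((1 / 2 : ℝ) ^ j) * K ^ (1 - (1 / 2 : ℝ) ^ j) := by
    intro j
    induction j with
    | zero =>
      intro z hz
      rw [pow_zero, Real.rpow_one, sub_self, Real.rpow_zero, mul_one]
      refine hsmall z (hball 0 ((closedBall_subset_closedBall (by linarith)) hz)) ?_
      rw [hc0] at hz
      exact lt_of_le_of_lt hz hρr
    | succ j ih =>
      intro z hz
      set a : ℝ := (1 / 2 : ℝ) ^ j with ha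
      have ha0 : 0 ≤ a := by rw [ha]; positivity
      have hε'0 : 0 < ε ^ a * K ^ (1 - a) :=
        mul_pos (Real.rpow_pos_of_pos hε _) (Real.rpow_pos_of_pos hK0 _)
      have hε'K : ε ^ a * K ^ (1 - a) ≤ K := by
        calc ε ^ a * K ^ (1 - a) ≤ K ^ a * K ^ (1 - a) :=
              mul_le_mul_of_nonneg_right (Real.rpow_le_rpow hε.le hεK ha0) (Real.rpow_nonneg hK0.le _)
          _ = K := by rw [← Real.rpow_add hK0]; simp
      have hz' : z ∈ closedBall (c j) (2 * ρ) := by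
        rw [mem_closedBall]
        calc dist z (c j) ≤ dist z (c (j + 1)) + dist (c (j + 1)) (c j) := dist_triangle _ _ _
          _ ≤ ρ + ρ := add_le_add hz (hstep j).le
          _ = 2 * ρ := by ring
      have key := norm_le_sqrt_of_three_circles hD hh hρ0 (hball j) hε'0 hε'K
        (fun w hw => hK w (hball j hw)) ih hz'
      rw [sqrt_interp_mul_sqrt hε hK0, ← pow_succ] at key
      exact key
  intro z hz
  have hzmem : z ∈ closedBall (c N) ρ := by
    rw [hcN]; exact ball_subset_closedBall hz
  exact hind N z hzmem

/-- **Two-constants estimate along disc chains with an exponent UNIFORM ON A COMPACT SET** (stub S2 of line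
`Sketch`, crux `FreeEnergyWindowChannel`).  For an open preconnected `D ⊆ ℂ`, a point `x ∈ D`, a radius
`r₀ > 0` and a compact `K ⊆ D` there is `θ ∈ (0, 1]` (depending only on `D, x, r₀, K`) such that every `h`
holomorphic on `D` with `‖h‖ ≤ B` on `D` and `‖h‖ ≤ ε ≤ B` on `D ∩ ball x r₀` satisfies
`‖h z‖ ≤ ε ^ θ * B ^ (1 - θ)` for ALL `z ∈ K`.  Proof: at every `y ∈ K` the local chain estimate
`exists_exponent_norm_le_on_ball` gives an exponent `θ_y` and a ball `ball y s_y` on which it holds; finitely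
many of these balls cover `K` (`IsCompact.elim_nhds_subcover`); take the least of the finitely many `θ_y`
(`Finset.exists_min_image`) and use that `ε ^ θ * B ^ (1 - θ)` is antitone in `θ` for `ε ≤ B`
(`rpow_interp_antitone`).  If the cover is empty then so is `K` and `θ = 1` works. [folklore] -/
theorem stub_chainOnCompacts :
    ∀ (D : Set ℂ), IsOpen D → IsPreconnected D → ∀ x ∈ D, ∀ r₀ : ℝ, 0 < r₀ →
      ∀ K : Set ℂ, IsCompact K → K ⊆ D →
        ∃ θ : ℝ, 0 < θ ∧ θ ≤ 1 ∧ ∀ (h : ℂ → ℂ) (B ε : ℝ), DifferentiableOn ℂ h D → 0 < ε → ε ≤ B →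
          (∀ z ∈ D, ‖h z‖ ≤ B) → (∀ z ∈ D, dist z x < r₀ → ‖h z‖ ≤ ε) →
            ∀ z ∈ K, ‖h z‖ ≤ ε ^ θ * B ^ (1 - θ) := by
  intro D hD hDc x hx r₀ hr₀ K hK hKD
  -- pointwise data: an exponent and a radius at every point of `D`
  have hpt : ∀ y ∈ D, ∃ θ : ℝ, 0 < θ ∧ θ ≤ 1 ∧ ∃ s : ℝ, 0 < s ∧ ∀ (h : ℂ → ℂ) (B ε : ℝ),
      DifferentiableOn ℂ h D → 0 < ε → ε ≤ B → (∀ z ∈ D, ‖h z‖ ≤ B) →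
        (∀ z ∈ D, dist z x < r₀ → ‖h z‖ ≤ ε) → ∀ z ∈ ball y s, ‖h z‖ ≤ ε ^ θ * B ^ (1 - θ) :=
    fun y hy => exists_exponent_norm_le_on_ball hD hDc hx hy hr₀
  choose! θ hθ0 hθ1 s hs0 hP using hpt
  -- a finite subcover of `K` by the balls `ball y (s y)`, `y ∈ K`
  obtain ⟨t, htK, hcover⟩ := hK.elim_nhds_subcover (fun y => ball y (s y))
    (fun y hy => ball_mem_nhds y (hs0 y (hKD hy)))
  rcases t.eq_empty_or_nonempty with ht | ht
  · -- the cover is empty, hence so is `K`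
    refine ⟨1, one_pos, le_rfl, ?_⟩
    intro _ _ _ _ _ _ _ _ z hz
    have hz' := hcover hz
    rw [ht] at hz'
    simp at hz'
  · -- the least exponent over the finite cover
    obtain ⟨y₀, hy₀t, hy₀⟩ := t.exists_min_image θ ht
    have hy₀D : y₀ ∈ D := hKD (htK y₀ hy₀t)
    refine ⟨θ y₀, hθ0 y₀ hy₀D, hθ1 y₀ hy₀D, ?_⟩
    intro h B ε hh hε hεB hB hsmall z hz
    obtain ⟨y, hyt, hzy⟩ := mem_iUnion₂.1 (hcover hz)
    have hyD : y ∈ D := hKD (htK y hyt)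
    calc ‖h z‖ ≤ ε ^ θ y * B ^ (1 - θ y) := hP y hyD h B ε hh hε hεB hB hsmall z hzy
      _ ≤ ε ^ θ y₀ * B ^ (1 - θ y₀) := rpow_interp_antitone hε hεB (hy₀ y hyt)

end Summit.QuantumFields.YangMills.Theorems.FreeEnergyWindowChannel
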